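import Literature.Geometry.DiscreteGeometry.DelsarteLinearProgrammingBound

/-!
# The degree-two linear programming bound `A(n, s) ≤ 2n(1-s)/(1-ns)` for `s < 1/n` (all `n ≥ 3`)

Framing: lottery ticket; floor = certified bounds/negative ranges. Venture `PackingBounds`
(cell `pub-packcert`), spherical-code family; closed-form + control containing the simplex
(`s = -1/n`: `n+1`) and orthoplex (`s = 0`: `2n`) bounds.

**Theorem.** Let `n ≥ 3` and `s < 1/n`. Every finite set `C` of unit vectors of `ℝⁿ` with pairwise
inner products `≤ s` satisfies `|C| (1 - n s) ≤ 2 n (1 - s)`. Proof: the degree-two Delsarte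
certificate `f(t) = (t+1)(t-s) = (1/n - s) C_0 + ((1-s)/(2μ)) C_1^{μ} + (1/(2μ(μ+1))) C_2^{μ}`
(`μ = (n-2)/2`, `C_1^{μ} = 2μt`, `C_2^{μ} = 2μ(μ+1)t² - μ`), nonpositive on `[-1, s]`, with
`f(1) = 2(1-s)`; symbolic-in-`(n, s)` instance of
`Literature.Geometry.DiscreteGeometry.DelsarteLP.card_mul_le`. (Levenshtein's bound `L_2(n,s)`;
Rankin 1955 for the two endpoint cases.)

## References
* P. Delsarte, J. M. Goethals, J. J. Seidel, Geom. Dedicata 6 (1977) 363–388, §4. [`DelsarteGoethalsSeidel1977`]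
* J. H. Conway, N. J. A. Sloane, *Sphere Packings, Lattices and Groups*, Ch. 9 §3. [`ConwaySloane1999`]
-/

namespace Summit.Ventures.PackingBounds.SphericalCodes

open Finset Literature.Analysis.SpecialFunctions Literature.Geometry.DiscreteGeometry

/-- The degree-two bound with the Gegenbauer parameter `μ` explicit (`n = 2μ + 2`, `μ > 0`):
`|C| · (1/(2μ+2) - s) ≤ 2 (1 - s)` for codes with inner products `≤ s < 1/(2μ+2)`.
[cite: DelsarteGoethalsSeidel1977, §4 (linear programming bound, degree-two example)] -/
theorem degree_two_card_mul_le_aux {n : ℕ} {μ : ℝ} (hnμ : (n : ℝ) = 2 * μ + 2) (hμ : 0 < μ)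
    (s : ℝ) (hs : s < 1 / (2 * μ + 2)) (hs1 : s ≤ 1)
    (C : Finset (EuclideanSpace ℝ (Fin n)))
    (h1 : ∀ x ∈ C, ‖x‖ = 1) (h2 : ∀ x ∈ C, ∀ y ∈ C, x ≠ y → inner ℝ x y ≤ s) :
    (C.card : ℝ) * (1 / (2 * μ + 2) - s) ≤ 2 * (1 - s) := by
  have hμ1 : (0 : ℝ) < μ + 1 := by linarith
  have hμne : μ ≠ 0 := hμ.ne'
  have hμ1ne : μ + 1 ≠ 0 := hμ1.ne'
  have h2μ : (2 : ℝ) * μ ≠ 0 := by positivity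
  have h2μ2 : (2 : ℝ) * μ + 2 ≠ 0 := by positivity
  have hC2 : ∀ t : ℝ, gegenbauerSum μ 2 t = 2 * μ * (μ + 1) * t ^ 2 - μ := by
    intro t
    simp [gegenbauerSum, gegenbauerCoeff, Finset.sum_range_succ, Finset.prod_range_succ,
      Nat.factorial]
    ring
  have hpoly : ∀ t : ℝ, ∑ k ∈ range (2 + 1),
      (fun k => match k with
        | 0 => 1 / (2 * μ + 2) - s | 1 => (1 - s) / (2 * μ) | 2 => 1 / (2 * μ * (μ + 1))
        | _ => 0) k * gegenbauerSum μ k t = (t + 1) * (t - s) := by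
    intro t
    simp only [Finset.sum_range_succ, Finset.sum_range_zero, zero_add, gegenbauerSum_zero,
      gegenbauerSum_one, hC2]
    field_simp
    ring
  have key := DelsarteLP.card_mul_le (n := n) (μ := μ) hnμ hμ 2
    (fun k => match k with
      | 0 => 1 / (2 * μ + 2) - s | 1 => (1 - s) / (2 * μ) | 2 => 1 / (2 * μ * (μ + 1)) | _ => 0)
    ?_ s ?_ C h1 h2
  · rw [hpoly] at key
    have key' : (C.card : ℝ) * (1 / (2 * μ + 2) - s) ≤ (1 + 1) * (1 - s) := key
    linarith
  · intro k
    split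
    · linarith
    · have : 0 ≤ 1 - s := by linarith
      positivity
    · positivity
    · exact le_refl 0
  · intro t ht1 ht2
    rw [hpoly]
    exact mul_nonpos_of_nonneg_of_nonpos (by linarith) (by linarith)

/-- **Degree-two LP bound** (`n ≥ 3`, `s < 1/n`): a finite set `C` of unit vectors of `ℝⁿ` with
pairwise inner products `≤ s` has `|C| · (1 - n s) ≤ 2 n (1 - s)`, i.e. `A(n,s) ≤ 2n(1-s)/(1-ns)`
(Levenshtein's `L_2`; simplex and cross-polytope cases `s = -1/n, 0`).
[cite: DelsarteGoethalsSeidel1977, §4 (linear programming bound, degree-two example)] -/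
theorem degree_two_card_mul_le (n : ℕ) (hn : 3 ≤ n) (s : ℝ) (hs : s < 1 / (n : ℝ))
    (C : Finset (EuclideanSpace ℝ (Fin n)))
    (h1 : ∀ x ∈ C, ‖x‖ = 1) (h2 : ∀ x ∈ C, ∀ y ∈ C, x ≠ y → inner ℝ x y ≤ s) :
    (C.card : ℝ) * (1 - (n : ℝ) * s) ≤ 2 * (n : ℝ) * (1 - s) := by
  have hn' : (3 : ℝ) ≤ n := by exact_mod_cast hn
  have hnpos : (0 : ℝ) < n := by linarith
  have hnne : (n : ℝ) ≠ 0 := hnpos.ne'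
  obtain ⟨μ, hnμ⟩ : ∃ μ : ℝ, (n : ℝ) = 2 * μ + 2 := ⟨((n : ℝ) - 2) / 2, by ring⟩
  have hμ : (0 : ℝ) < μ := by linarith
  have hs1 : s ≤ 1 := by
    have : 1 / (n : ℝ) ≤ 1 := by rw [div_le_one hnpos]; linarith
    linarith
  have hs'' : s < 1 / (2 * μ + 2) := by rw [← hnμ]; exact hs
  have key := degree_two_card_mul_le_aux hnμ hμ s hs'' hs1 C h1 h2
  rw [← hnμ] at key
  -- key : card * (1/n - s) ≤ 2 (1 - s); multiply by n
  have hmul := mul_le_mul_of_nonneg_left key hnpos.le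
  have e1 : (n : ℝ) * ((C.card : ℝ) * (1 / (n : ℝ) - s)) = (C.card : ℝ) * (1 - (n : ℝ) * s) := by
    field_simp
  rw [e1] at hmul
  linarith

end Summit.Ventures.PackingBounds.SphericalCodes
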